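import Summits.RiemannHypothesis.RiemannHypothesis.Theorems.WeilTwoPrimeDeflM80FBase
import Literature.NumberTheory.LFunctions.WeilBlockRowsFast
import HarnessLib

/-!
# Deflated two-prime certificate (weilCertDeflM80F): the Bessel block claim `Hp = C H Cᵀ` (parity 1), rows 15–19, fast check

`WeilCert.checkHpRowT` (linear traversals) instead of the indexed `checkHpRow` decide.  Pure proof file.
-/

set_option linter.dupNamespace false

noncomputable section

namespace Summit.RiemannHypothesis.RiemannHypothesis.Theorems.EvenWinsBeyondArch

open Literature.NumberTheory.LFunctions

set_option maxHeartbeats 0 in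
/-- Fast kernel check of claim row 15 of `Hp = C H Cᵀ` (parity 1; linear traversals, triangular `C`). [folklore] -/
theorem checkHpRowT1_15_weilCertDeflM80F : weilCertDeflM80FBase.checkHpRowT weilCertDeflM80FHpO 1 15 = true := by
  decide +kernel

/-- Claim row 15 of `Hp = C H Cᵀ` (parity 1), from the fast check. [folklore] -/
theorem checkHpRow1_15_weilCertDeflM80F : weilCertDeflM80FBase.checkHpRow weilCertDeflM80FHpO 1 15 = true :=
  WeilCert.checkHpRow_of_T checkHpRowT1_15_weilCertDeflM80F

set_option maxHeartbeats 0 in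
/-- Fast kernel check of claim row 16 of `Hp = C H Cᵀ` (parity 1; linear traversals, triangular `C`). [folklore] -/
theorem checkHpRowT1_16_weilCertDeflM80F : weilCertDeflM80FBase.checkHpRowT weilCertDeflM80FHpO 1 16 = true := by
  decide +kernel

/-- Claim row 16 of `Hp = C H Cᵀ` (parity 1), from the fast check. [folklore] -/
theorem checkHpRow1_16_weilCertDeflM80F : weilCertDeflM80FBase.checkHpRow weilCertDeflM80FHpO 1 16 = true :=
  WeilCert.checkHpRow_of_T checkHpRowT1_16_weilCertDeflM80F

set_option maxHeartbeats 0 in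
/-- Fast kernel check of claim row 17 of `Hp = C H Cᵀ` (parity 1; linear traversals, triangular `C`). [folklore] -/
theorem checkHpRowT1_17_weilCertDeflM80F : weilCertDeflM80FBase.checkHpRowT weilCertDeflM80FHpO 1 17 = true := by
  decide +kernel

/-- Claim row 17 of `Hp = C H Cᵀ` (parity 1), from the fast check. [folklore] -/
theorem checkHpRow1_17_weilCertDeflM80F : weilCertDeflM80FBase.checkHpRow weilCertDeflM80FHpO 1 17 = true :=
  WeilCert.checkHpRow_of_T checkHpRowT1_17_weilCertDeflM80F

set_option maxHeartbeats 0 in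
/-- Fast kernel check of claim row 18 of `Hp = C H Cᵀ` (parity 1; linear traversals, triangular `C`). [folklore] -/
theorem checkHpRowT1_18_weilCertDeflM80F : weilCertDeflM80FBase.checkHpRowT weilCertDeflM80FHpO 1 18 = true := by
  decide +kernel

/-- Claim row 18 of `Hp = C H Cᵀ` (parity 1), from the fast check. [folklore] -/
theorem checkHpRow1_18_weilCertDeflM80F : weilCertDeflM80FBase.checkHpRow weilCertDeflM80FHpO 1 18 = true :=
  WeilCert.checkHpRow_of_T checkHpRowT1_18_weilCertDeflM80F

set_option maxHeartbeats 0 in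
/-- Fast kernel check of claim row 19 of `Hp = C H Cᵀ` (parity 1; linear traversals, triangular `C`). [folklore] -/
theorem checkHpRowT1_19_weilCertDeflM80F : weilCertDeflM80FBase.checkHpRowT weilCertDeflM80FHpO 1 19 = true := by
  decide +kernel

/-- Claim row 19 of `Hp = C H Cᵀ` (parity 1), from the fast check. [folklore] -/
theorem checkHpRow1_19_weilCertDeflM80F : weilCertDeflM80FBase.checkHpRow weilCertDeflM80FHpO 1 19 = true :=
  WeilCert.checkHpRow_of_T checkHpRowT1_19_weilCertDeflM80F

end Summit.RiemannHypothesis.RiemannHypothesis.Theorems.EvenWinsBeyondArch
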